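import Literature.AnabelianGeometry.EtaleTheta.Discharge.Sec5Thm57OfConnectedTemperoidChosen
import Literature.AnabelianGeometry.EtaleTheta.Discharge.Sec5ConstEmbOfTerminal

/-!
# [EtTh] §5, Theorem 5.7 at ALL levels for the genuine connected-base tower, chosen-family form, constants pulled back from the base curve (pp. 329–331 / PDF pp. 103–105)

Mochizuki, *The étale theta function …*, Publ. RIMS **45** (2009)
[cite: MochizukiEtTh2009, Thm 5.7 p.330 (PDF p.104); Def 3.6 (iii) p.303 (PDF p.77); Lem 5.8 p.331 (PDF p.105)].  Seat
abc-iut-L2-d4 (gen 4; node `EtTh:Thm5.7`); PROOF-ONLY re-knit of `thetaRootPreservedAll_ofConnectedTemperoidYddFamily_ofChosen`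
(p431903) with the constant embeddings in abc-iut-w4-d008's TERMINAL-OBJECT SHAPE (`Discharge/Sec5ConstEmbOfTerminal.lean`,
p431786): `constEmb_N := B(t_N)^× ∘ c₀ : K'^× → O^×(B_N^birat)` for arrows `t_N : B_N^bs → X₀` into a base object `X₀` receiving
at most one arrow from every object of `B^temp(Π^tp_X)⁰` (the curve `X` itself as the one-point `Π^tp_X`-set:
`ConnectedPunit.subsingleton_hom`) and ONE embedding `c₀ : K'^× → B(X₀)^×` ("the natural inclusion `K^× ↪ O^×(B_N^birat)`" of
Lemma 5.8 is the pull-back of the constant rational functions of `X`).  For this shape two binders of the (A) list are THEOREMS: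
* Def. 3.6 (iii) at level 1 (constants are `Aut_C(B_1)`-fixed) := `TemperedFrobenioid.biratAutModel_unitsMap_comp_apply_of_subsingleton`;
* naturality of the constants along `β_{1,N}` := `TemperedFrobenioid.ratFnFunctor_map_unitsMap_comp_of_subsingleton`.
REMAINING binders of `thetaRootPreservedAll_ofConnectedTemperoidYddFamily_ofChosen_ofPulledConstants`: `hnd`, `hN`, `hgc₁`, `hfac₁`
(abstract `tf`), the injectivity `hinj` of the composite embeddings (NOT a field of the abstract Def. 3.6 data — w4-d008's remark),
the chosen family (`αf βf ef Dcf Dpf hT hT' hu hΨα hΨβ he θ₁ hstrv₁ hYdd₁`) and `hc`.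
HONEST FRAMING: a kernel-checked implication for data so parametrised (the class `TemperedFrobenioid T₀ (ConnectedPart (BTemp
X.Pi)) VD` is not shown inhabited here); nothing asserts any result of [EtTh] unconditionally; typed ≠ discharged; no side taken
on anything downstream. -/

noncomputable section

namespace Literature.AnabelianGeometry.EtaleTheta

open CategoryTheory Opposite Literature.AlgebraicGeometry.Frobenioids Literature.AnabelianGeometry.SemiGraphs
  Literature.AnabelianGeometry.SemiGraphs.GaloisObjects

universe u₀ v₀ w

namespace ThetaFrobenioidTower

variable {K : Type u₀} [Field K] {X : SemiGraphs.TemperedArithmeticGroup.{u₀} K} {D₀ : Type u₀} [Category.{v₀} D₀]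
  {V : FrdIMonoidStub.{w}} {T₀ : RealifiedDivisorMonoids (D₀ := D₀) V}
  {VD : FrdICatStub.{u₀ + 1, u₀, w} (ConnectedPart (BTemp X.Pi))}
  {tf : TemperedFrobenioid T₀ (ConnectedPart (BTemp X.Pi)) VD} {hZ : tf.monoidType = MonoidType.Z}
  {hP : ∀ A : (ConnectedPart (BTemp X.Pi))ᵒᵖ, IsPerfect (tf.Φ.carrier A)}
  {NH : Subgroup (Field.absoluteGaloisGroup K) → tf.category → ℕ+ → Prop}
  {E : Set ℕ+} (𝒯 : ThetaEnvTower.{max u₀ w} E) (ιX : 𝒯.PiX ≃ₜ* X.Pi)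
  {pullFrac : ∀ {A A' : (BiKummerSetting.mkOfConnectedTemperoidYddTower X tf hZ hP NH 𝒯 ιX).C} (_ : A' ⟶ A),
    (BiKummerSetting.mkOfConnectedTemperoidYddTower X tf hZ hP NH 𝒯 ιX).biratUnits A →
      (BiKummerSetting.mkOfConnectedTemperoidYddTower X tf hZ hP NH 𝒯 ιX).biratUnits A'}
  {lv : ℕ+}
  {θ : (BiKummerSetting.mkOfConnectedTemperoidYddTower X tf hZ hP NH 𝒯 ιX).biratUnits
    (BiKummerSetting.mkOfConnectedTemperoidYddTower X tf hZ hP NH 𝒯 ιX).Aodot}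
  {Bl : (BiKummerSetting.mkOfConnectedTemperoidYddTower X tf hZ hP NH 𝒯 ιX).C}
  {Pl : (BiKummerSetting.mkOfConnectedTemperoidYddTower X tf hZ hP NH 𝒯 ιX).FractionPair θ Bl}
  {Rl : (BiKummerSetting.mkOfConnectedTemperoidYddTower X tf hZ hP NH 𝒯 ιX).NthRoot θ Pl lv pullFrac}
  (h : ModelFrobenioid.Hypotheses tf.divisorMonoid tf.ratFnFunctor)
  (Q : FrobenioidTheta.ThetaSubquotientStub.{w} (ConnectedPart (BTemp X.Pi))) (odd_l : Odd (lv : ℕ))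
  (R : ∀ N : ℕ+, (BiKummerSetting.mkOfConnectedTemperoidYddTower X tf hZ hP NH 𝒯 ιX).NthRoot Rl.root Rl.pair N pullFrac)
  (K' : Type w) [Field K'] {X₀ : ConnectedPart (BTemp X.Pi)}
  (hX₀ : ∀ Y : ConnectedPart (BTemp X.Pi), Subsingleton (Y ⟶ X₀)) (t : ∀ N : ℕ+, (R N).BN.base ⟶ X₀)
  (c₀ : K'ˣ →* (tf.ratFnFunctor.obj (op X₀))ˣ)
  (hinj : ∀ N : ℕ+, Function.Injective ((Units.map (tf.ratFnFunctor.map (t N).op).hom).comp c₀))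
  (hinvc : ∀ (N : ℕ+) (g : Aut (R N).AN.base),
    pull tf.divisorMonoid g.hom (ModelFrobenioid.div (R N).pair.num) = ModelFrobenioid.div (R N).pair.num)
  (hinvp : ∀ (N : ℕ+) (y : 𝒯.PiX), y ∈ 𝒯.PiYdd →
    pull tf.divisorMonoid ((BiKummerSetting.mkOfConnectedTemperoidYddTower X tf hZ hP NH 𝒯 ιX).galoisSurj (R N).AN.base
      (R N).αData.isGalois (ιX y)).hom (ModelFrobenioid.div (R N).pair.den) = ModelFrobenioid.div (R N).pair.den)
  (α : ∀ {N N' : ℕ+}, (N : ℕ) ∣ N' → ((R N').AN ⟶ (R N).AN))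
  (β : ∀ {N N' : ℕ+}, (N : ℕ) ∣ N' → ((R N').BN ⟶ (R N).BN))
  (comm_sCap : ∀ {N N' : ℕ+} (hd : (N : ℕ) ∣ N'), (R N').pair.num ≫ β hd = α hd ≫ (R N).pair.num)
  (comm_sCup : ∀ {N N' : ℕ+} (hd : (N : ℕ) ∣ N'), (R N').pair.den ≫ β hd = α hd ≫ (R N).pair.den)
  (isIsometry_α : ∀ {N N' : ℕ+} (hd : (N : ℕ) ∣ N'),
    ((BiKummerSetting.mkOfConnectedTemperoidYddTower X tf hZ hP NH 𝒯 ιX).sec5Stub h).pre.IsIsometry (α hd))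
  (degFr_α : ∀ {N N' : ℕ+} (hd : (N : ℕ) ∣ N'),
    (((BiKummerSetting.mkOfConnectedTemperoidYddTower X tf hZ hP NH 𝒯 ιX).sec5Stub h).pre.degFr (α hd) : ℕ) * N = N')
  (isIsometry_β : ∀ {N N' : ℕ+} (hd : (N : ℕ) ∣ N'),
    ((BiKummerSetting.mkOfConnectedTemperoidYddTower X tf hZ hP NH 𝒯 ιX).sec5Stub h).pre.IsIsometry (β hd))
  (degFr_β : ∀ {N N' : ℕ+} (hd : (N : ℕ) ∣ N'),
    (((BiKummerSetting.mkOfConnectedTemperoidYddTower X tf hZ hP NH 𝒯 ιX).sec5Stub h).pre.degFr (β hd) : ℕ) * N = N')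
  (baseFrob_α : ∀ {N N' : ℕ+} (hd : (N : ℕ) ∣ N'),
    (BiKummerSetting.mkOfConnectedTemperoidYddTower X tf hZ hP NH 𝒯 ιX).IsOfBaseFrobeniusType (α hd))

include hX₀ h in
/-- **[EtTh] Theorem 5.7 (root level) at ALL levels for the §5 tower over `B^temp(Π^tp_X)⁰` with `A_⊙^bs := Ÿ`, from ONE
compatible family of transport data, with the constants PULLED BACK from one base object `X₀`** (`constEmb_N := B(t_N)^× ∘ c₀`,
`X₀` receiving at most one arrow from every object — e.g. the one-point `Π^tp_X`-set = the curve `X`, `ConnectedPunit.subsingleton_hom`):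
the binders for Def. 3.6 (iii) and for the naturality of the constants along `β_{1,N}` are DISCHARGED by abc-iut-w4-d008's
`biratAutModel_unitsMap_comp_apply_of_subsingleton` / `ratFnFunctor_map_unitsMap_comp_of_subsingleton` (p431786).
[cite: MochizukiEtTh2009, Thm 5.7 p.329–330 (PDF pp.103–104); Def 3.6 (iii) p.303 (PDF p.77); Lem 5.8 p.331 (PDF p.105)] -/
theorem thetaRootPreservedAll_ofConnectedTemperoidYddFamily_ofChosen_ofPulledConstants
    (hnd : IsNonDilatingOn tf.divisorMonoid)
    (hN : ∃ A : (BiKummerSetting.mkOfConnectedTemperoidYddTower X tf hZ hP NH 𝒯 ιX).C, ¬ (PreFrobenioidData.ofModel tf.divisorMonoid tf.ratFnFunctor tf.divBNatTrans).IsGroupLikeObj A)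
    (hgc₁ : ∀ u : (ThetaFrobenioid.ofConnectedTemperoidData (T := 𝒯.level ⟨1, 𝒯.one_mem⟩) h Q odd_l (R 1) ιX K'
        ((Units.map (tf.ratFnFunctor.map (t 1).op).hom).comp c₀) (hinj 1) (hinvc 1) (hinvp 1)).units (ThetaFrobenioid.ofConnectedTemperoidData (T := 𝒯.level ⟨1, 𝒯.one_mem⟩) h Q odd_l (R 1) ιX K'
        ((Units.map (tf.ratFnFunctor.map (t 1).op).hom).comp c₀) (hinj 1) (hinvc 1) (hinvp 1)).BN,
      (∀ y ∈ (ThetaFrobenioid.ofConnectedTemperoidData (T := 𝒯.level ⟨1, 𝒯.one_mem⟩) h Q odd_l (R 1) ιX K'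
        ((Units.map (tf.ratFnFunctor.map (t 1).op).hom).comp c₀) (hinj 1) (hinvc 1) (hinvp 1)).imPiY, (ThetaFrobenioid.ofConnectedTemperoidData (T := 𝒯.level ⟨1, 𝒯.one_mem⟩) h Q odd_l (R 1) ιX K'
        ((Units.map (tf.ratFnFunctor.map (t 1).op).hom).comp c₀) (hinj 1) (hinvc 1) (hinvp 1)).sgpCap y * (u : Aut (ThetaFrobenioid.ofConnectedTemperoidData (T := 𝒯.level ⟨1, 𝒯.one_mem⟩) h Q odd_l (R 1) ιX K'
        ((Units.map (tf.ratFnFunctor.map (t 1).op).hom).comp c₀) (hinj 1) (hinvc 1) (hinvp 1)).BN) * ((ThetaFrobenioid.ofConnectedTemperoidData (T := 𝒯.level ⟨1, 𝒯.one_mem⟩) h Q odd_l (R 1) ιX K'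
        ((Units.map (tf.ratFnFunctor.map (t 1).op).hom).comp c₀) (hinj 1) (hinvc 1) (hinvp 1)).sgpCap y)⁻¹ = u) → (ThetaFrobenioid.ofConnectedTemperoidData (T := 𝒯.level ⟨1, 𝒯.one_mem⟩) h Q odd_l (R 1) ιX K'
        ((Units.map (tf.ratFnFunctor.map (t 1).op).hom).comp c₀) (hinj 1) (hinvc 1) (hinvp 1)).unitsToBirat (ThetaFrobenioid.ofConnectedTemperoidData (T := 𝒯.level ⟨1, 𝒯.one_mem⟩) h Q odd_l (R 1) ιX K'
        ((Units.map (tf.ratFnFunctor.map (t 1).op).hom).comp c₀) (hinj 1) (hinvc 1) (hinvp 1)).BN u ∈ (ThetaFrobenioid.ofConnectedTemperoidData (T := 𝒯.level ⟨1, 𝒯.one_mem⟩) h Q odd_l (R 1) ιX K'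
        ((Units.map (tf.ratFnFunctor.map (t 1).op).hom).comp c₀) (hinj 1) (hinvc 1) (hinvp 1)).constEmb.range)
    (Ψ : (BiKummerSetting.mkOfConnectedTemperoidYddTower X tf hZ hP NH 𝒯 ιX).C ≌
      (BiKummerSetting.mkOfConnectedTemperoidYddTower X tf hZ hP NH 𝒯 ιX).C)
    (hfac₁ : ∀ y ∈ ((ofConnectedTemperoidFamily h Q odd_l R ιX K' (fun N => (Units.map (tf.ratFnFunctor.map (t N).op).hom).comp c₀)
      hinj hinvc hinvp α β comm_sCap comm_sCup isIsometry_α degFr_α isIsometry_β degFr_β baseFrob_α).atLevel 1).imPiY, ∃ x ∈ ((ofConnectedTemperoidFamily h Q odd_l R ιX K' (fun N => (Units.map (tf.ratFnFunctor.map (t N).op).hom).comp c₀)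
      hinj hinvc hinvp α β comm_sCap comm_sCup isIsometry_α degFr_α isIsometry_β degFr_β baseFrob_α).atLevel 1).HB, ∀ u ∈ ((ofConnectedTemperoidFamily h Q odd_l R ιX K' (fun N => (Units.map (tf.ratFnFunctor.map (t N).op).hom).comp c₀)
      hinj hinvc hinvp α β comm_sCap comm_sCup isIsometry_α degFr_α isIsometry_β degFr_β baseFrob_α).atLevel 1).units ((ofConnectedTemperoidFamily h Q odd_l R ιX K' (fun N => (Units.map (tf.ratFnFunctor.map (t N).op).hom).comp c₀)
      hinj hinvc hinvp α β comm_sCap comm_sCup isIsometry_α degFr_α isIsometry_β degFr_β baseFrob_α).BN 1),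
      (ofConnectedTemperoidFamily h Q odd_l R ιX K' (fun N => (Units.map (tf.ratFnFunctor.map (t N).op).hom).comp c₀)
      hinj hinvc hinvp α β comm_sCap comm_sCup isIsometry_α degFr_α isIsometry_β degFr_β baseFrob_α).sgpCap 1 y * u * ((ofConnectedTemperoidFamily h Q odd_l R ιX K' (fun N => (Units.map (tf.ratFnFunctor.map (t N).op).hom).comp c₀)
      hinj hinvc hinvp α β comm_sCap comm_sCup isIsometry_α degFr_α isIsometry_β degFr_β baseFrob_α).sgpCap 1 y)⁻¹ = (ofConnectedTemperoidFamily h Q odd_l R ιX K' (fun N => (Units.map (tf.ratFnFunctor.map (t N).op).hom).comp c₀)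
      hinj hinvc hinvp α β comm_sCap comm_sCup isIsometry_α degFr_α isIsometry_β degFr_β baseFrob_α).sgpCap 1 x * u * ((ofConnectedTemperoidFamily h Q odd_l R ιX K' (fun N => (Units.map (tf.ratFnFunctor.map (t N).op).hom).comp c₀)
      hinj hinvc hinvp α β comm_sCap comm_sCup isIsometry_α degFr_α isIsometry_β degFr_β baseFrob_α).sgpCap 1 x)⁻¹)
    (αf : ∀ N : ℕ+, Ψ.functor.obj ((ofConnectedTemperoidFamily h Q odd_l R ιX K' (fun N => (Units.map (tf.ratFnFunctor.map (t N).op).hom).comp c₀)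
      hinj hinvc hinvp α β comm_sCap comm_sCup isIsometry_α degFr_α isIsometry_β degFr_β baseFrob_α).AN N) ≅ (ofConnectedTemperoidFamily h Q odd_l R ιX K' (fun N => (Units.map (tf.ratFnFunctor.map (t N).op).hom).comp c₀)
      hinj hinvc hinvp α β comm_sCap comm_sCup isIsometry_α degFr_α isIsometry_β degFr_β baseFrob_α).AN N) (βf : ∀ N : ℕ+, Ψ.functor.obj ((ofConnectedTemperoidFamily h Q odd_l R ιX K' (fun N => (Units.map (tf.ratFnFunctor.map (t N).op).hom).comp c₀)
      hinj hinvc hinvp α β comm_sCap comm_sCup isIsometry_α degFr_α isIsometry_β degFr_β baseFrob_α).BN N) ≅ (ofConnectedTemperoidFamily h Q odd_l R ιX K' (fun N => (Units.map (tf.ratFnFunctor.map (t N).op).hom).comp c₀)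
      hinj hinvc hinvp α β comm_sCap comm_sCup isIsometry_α degFr_α isIsometry_β degFr_β baseFrob_α).BN N)
    (ef : ∀ N : ℕ+, (ofConnectedTemperoidFamily h Q odd_l R ιX K' (fun N => (Units.map (tf.ratFnFunctor.map (t N).op).hom).comp c₀)
      hinj hinvc hinvp α β comm_sCap comm_sCup isIsometry_α degFr_α isIsometry_β degFr_β baseFrob_α).AN N ≅ (ofConnectedTemperoidFamily h Q odd_l R ιX K' (fun N => (Units.map (tf.ratFnFunctor.map (t N).op).hom).comp c₀)
      hinj hinvc hinvp α β comm_sCap comm_sCup isIsometry_α degFr_α isIsometry_β degFr_β baseFrob_α).AN N) (Dcf Dpf : ∀ N : ℕ+, Aut ((ofConnectedTemperoidFamily h Q odd_l R ιX K' (fun N => (Units.map (tf.ratFnFunctor.map (t N).op).hom).comp c₀)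
      hinj hinvc hinvp α β comm_sCap comm_sCup isIsometry_α degFr_α isIsometry_β degFr_β baseFrob_α).BN N))
    (hT : ∀ N : ℕ+, (αf N).inv ≫ Ψ.functor.map ((ofConnectedTemperoidFamily h Q odd_l R ιX K' (fun N => (Units.map (tf.ratFnFunctor.map (t N).op).hom).comp c₀)
      hinj hinvc hinvp α β comm_sCap comm_sCup isIsometry_α degFr_α isIsometry_β degFr_β baseFrob_α).sCap N) ≫ (βf N).hom = (ef N).hom ≫ (ofConnectedTemperoidFamily h Q odd_l R ιX K' (fun N => (Units.map (tf.ratFnFunctor.map (t N).op).hom).comp c₀)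
      hinj hinvc hinvp α β comm_sCap comm_sCup isIsometry_α degFr_α isIsometry_β degFr_β baseFrob_α).sCap N ≫ (Dcf N).hom)
    (hT' : ∀ N : ℕ+, (αf N).inv ≫ Ψ.functor.map ((ofConnectedTemperoidFamily h Q odd_l R ιX K' (fun N => (Units.map (tf.ratFnFunctor.map (t N).op).hom).comp c₀)
      hinj hinvc hinvp α β comm_sCap comm_sCup isIsometry_α degFr_α isIsometry_β degFr_β baseFrob_α).sCup N) ≫ (βf N).hom = (ef N).hom ≫ (ofConnectedTemperoidFamily h Q odd_l R ιX K' (fun N => (Units.map (tf.ratFnFunctor.map (t N).op).hom).comp c₀)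
      hinj hinvc hinvp α β comm_sCap comm_sCup isIsometry_α degFr_α isIsometry_β degFr_β baseFrob_α).sCup N ≫ (Dpf N).hom)
    (hu : ∀ N : ℕ+, (Dcf N)⁻¹ * Dpf N ∈ ((ofConnectedTemperoidFamily h Q odd_l R ιX K' (fun N => (Units.map (tf.ratFnFunctor.map (t N).op).hom).comp c₀)
      hinj hinvc hinvp α β comm_sCap comm_sCup isIsometry_α degFr_α isIsometry_β degFr_β baseFrob_α).atLevel N).units ((ofConnectedTemperoidFamily h Q odd_l R ιX K' (fun N => (Units.map (tf.ratFnFunctor.map (t N).op).hom).comp c₀)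
      hinj hinvc hinvp α β comm_sCap comm_sCup isIsometry_α degFr_α isIsometry_β degFr_β baseFrob_α).BN N))
    (hΨα : ∀ N : ℕ+,
      (αf N).inv ≫ Ψ.functor.map ((ofConnectedTemperoidFamily h Q odd_l R ιX K' (fun N => (Units.map (tf.ratFnFunctor.map (t N).op).hom).comp c₀)
      hinj hinvc hinvp α β comm_sCap comm_sCup isIsometry_α degFr_α isIsometry_β degFr_β baseFrob_α).α (one_dvd_level N)) ≫ (αf 1).hom = (ofConnectedTemperoidFamily h Q odd_l R ιX K' (fun N => (Units.map (tf.ratFnFunctor.map (t N).op).hom).comp c₀)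
      hinj hinvc hinvp α β comm_sCap comm_sCup isIsometry_α degFr_α isIsometry_β degFr_β baseFrob_α).α (one_dvd_level N))
    (hΨβ : ∀ N : ℕ+,
      (βf N).inv ≫ Ψ.functor.map ((ofConnectedTemperoidFamily h Q odd_l R ιX K' (fun N => (Units.map (tf.ratFnFunctor.map (t N).op).hom).comp c₀)
      hinj hinvc hinvp α β comm_sCap comm_sCup isIsometry_α degFr_α isIsometry_β degFr_β baseFrob_α).β (one_dvd_level N)) ≫ (βf 1).hom = (ofConnectedTemperoidFamily h Q odd_l R ιX K' (fun N => (Units.map (tf.ratFnFunctor.map (t N).op).hom).comp c₀)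
      hinj hinvc hinvp α β comm_sCap comm_sCup isIsometry_α degFr_α isIsometry_β degFr_β baseFrob_α).β (one_dvd_level N))
    (he : ∀ N : ℕ+, (ofConnectedTemperoidFamily h Q odd_l R ιX K' (fun N => (Units.map (tf.ratFnFunctor.map (t N).op).hom).comp c₀)
      hinj hinvc hinvp α β comm_sCap comm_sCup isIsometry_α degFr_α isIsometry_β degFr_β baseFrob_α).α (one_dvd_level N) ≫ (ef 1).hom = (ef N).hom ≫ (ofConnectedTemperoidFamily h Q odd_l R ιX K' (fun N => (Units.map (tf.ratFnFunctor.map (t N).op).hom).comp c₀)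
      hinj hinvc hinvp α β comm_sCap comm_sCup isIsometry_α degFr_α isIsometry_β degFr_β baseFrob_α).α (one_dvd_level N))
    (θ₁ : Aut ((ofConnectedTemperoidFamily h Q odd_l R ιX K' (fun N => (Units.map (tf.ratFnFunctor.map (t N).op).hom).comp c₀)
      hinj hinvc hinvp α β comm_sCap comm_sCup isIsometry_α degFr_α isIsometry_β degFr_β baseFrob_α).pre.base.obj ((ofConnectedTemperoidFamily h Q odd_l R ιX K' (fun N => (Units.map (tf.ratFnFunctor.map (t N).op).hom).comp c₀)
      hinj hinvc hinvp α β comm_sCap comm_sCup isIsometry_α degFr_α isIsometry_β degFr_β baseFrob_α).BN 1)) ≃* Aut ((ofConnectedTemperoidFamily h Q odd_l R ιX K' (fun N => (Units.map (tf.ratFnFunctor.map (t N).op).hom).comp c₀)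
      hinj hinvc hinvp α β comm_sCap comm_sCup isIsometry_α degFr_α isIsometry_β degFr_β baseFrob_α).pre.base.obj ((ofConnectedTemperoidFamily h Q odd_l R ιX K' (fun N => (Units.map (tf.ratFnFunctor.map (t N).op).hom).comp c₀)
      hinj hinvc hinvp α β comm_sCap comm_sCup isIsometry_α degFr_α isIsometry_β degFr_β baseFrob_α).BN 1)))
    (hstrv₁ : ((ofConnectedTemperoidFamily h Q odd_l R ιX K' (fun N => (Units.map (tf.ratFnFunctor.map (t N).op).hom).comp c₀)
      hinj hinvc hinvp α β comm_sCap comm_sCup isIsometry_α degFr_α isIsometry_β degFr_β baseFrob_α).atLevel 1).StrvTransport Ψ (αf 1) (ef 1) θ₁)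
    (hYdd₁ : ((ofConnectedTemperoidFamily h Q odd_l R ιX K' (fun N => (Units.map (tf.ratFnFunctor.map (t N).op).hom).comp c₀)
      hinj hinvc hinvp α β comm_sCap comm_sCup isIsometry_α degFr_α isIsometry_β degFr_β baseFrob_α).atLevel 1).HB.map θ₁.toMonoidHom = ((ofConnectedTemperoidFamily h Q odd_l R ιX K' (fun N => (Units.map (tf.ratFnFunctor.map (t N).op).hom).comp c₀)
      hinj hinvc hinvp α β comm_sCap comm_sCup isIsometry_α degFr_α isIsometry_β degFr_β baseFrob_α).atLevel 1).HB)
    (hc : ∀ c : (ofConnectedTemperoidFamily h Q odd_l R ιX K' (fun N => (Units.map (tf.ratFnFunctor.map (t N).op).hom).comp c₀)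
      hinj hinvc hinvp α β comm_sCap comm_sCup isIsometry_α degFr_α isIsometry_β degFr_β baseFrob_α).Kˣ, ((ofConnectedTemperoidFamily h Q odd_l R ιX K' (fun N => (Units.map (tf.ratFnFunctor.map (t N).op).hom).comp c₀)
      hinj hinvc hinvp α β comm_sCap comm_sCup isIsometry_α degFr_α isIsometry_β degFr_β baseFrob_α).atLevel 1).unitsToBirat ((ofConnectedTemperoidFamily h Q odd_l R ιX K' (fun N => (Units.map (tf.ratFnFunctor.map (t N).op).hom).comp c₀)
      hinj hinvc hinvp α β comm_sCap comm_sCup isIsometry_α degFr_α isIsometry_β degFr_β baseFrob_α).BN 1) ⟨(Dcf 1)⁻¹ * Dpf 1, hu 1⟩ = (ofConnectedTemperoidFamily h Q odd_l R ιX K' (fun N => (Units.map (tf.ratFnFunctor.map (t N).op).hom).comp c₀)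
      hinj hinvc hinvp α β comm_sCap comm_sCup isIsometry_α degFr_α isIsometry_β degFr_β baseFrob_α).constEmb 1 c →
      c ^ (2 * (ofConnectedTemperoidFamily h Q odd_l R ιX K' (fun N => (Units.map (tf.ratFnFunctor.map (t N).op).hom).comp c₀)
      hinj hinvc hinvp α β comm_sCap comm_sCup isIsometry_α degFr_α isIsometry_β degFr_β baseFrob_α).l) = 1) :
    (ofConnectedTemperoidFamily h Q odd_l R ιX K' (fun N => (Units.map (tf.ratFnFunctor.map (t N).op).hom).comp c₀)
      hinj hinvc hinvp α β comm_sCap comm_sCup isIsometry_α degFr_α isIsometry_β degFr_β baseFrob_α).ThetaRootPreservedAll Ψ := by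
  haveI := hX₀
  have H₁ := ThetaFrobenioid.facts_ofConnectedTemperoidData (T := 𝒯.level ⟨1, 𝒯.one_mem⟩) h Q odd_l (R 1) ιX K'
    ((Units.map (tf.ratFnFunctor.map (t 1).op).hom).comp c₀) (hinj 1) (hinvc 1) (hinvp 1)
    (BiKummerSetting.hH_mkOfConnectedTemperoidYddTower X tf hZ hP NH 𝒯 ιX)
    (tf.biratAutModel_unitsMap_comp_apply_of_subsingleton (R 1).BN (t 1) c₀) hgc₁
  refine ThetaFrobenioidTower.thetaRootPreservedAll_of_chosenFamily _ Ψ ?_ ?_ H₁.sgpCapSpec H₁.sgpCupSpec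
    H₁.biKummerDifferenceMem H₁.constantsActByCyclotome hfac₁ αf βf ef Dcf Dpf hT hT' hu hΨα hΨβ he ?_ θ₁ hstrv₁
    hYdd₁ hc
  · exact ThetaFrobenioid.epi_of_model (DivB := tf.divBNatTrans) h
  · delta ofConnectedTemperoidFamily
    exact hconst_ofBiKummerFamily' h _ Q odd_l R ιX
      (fun N => BiKummerSetting.mkOfConnectedTemperoid_isOpen_ker_galoisSurj X tf hZ hP NH _ _ _ (R N).AN.base
        (R N).αData.isGalois)
      _ K' (fun N => (Units.map (tf.ratFnFunctor.map (t N).op).hom).comp c₀) hinj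
      (fun N => ThetaFrobenioid.hdivc_of_pull_invariant h.isDivisorial (R N) (ThetaFrobenioid.strvOfBiKummerData h (R N))
        (ThetaFrobenioid.baseMap_strvOfBiKummerData h (R N)) (hinvc N))
      (div_strv_comp_den_connFamily h R ιX hinvp)
      α β comm_sCap comm_sCup isIsometry_α degFr_α isIsometry_β degFr_β baseFrob_α
      (fun hd => rho_comm_β_of_natural R ιX
        (BiKummerSetting.mkOfConnectedTemperoid_galoisSurj_natural X tf hZ hP NH _ _ _) α β comm_sCap hd)
      (fun N c => tf.ratFnFunctor_map_unitsMap_comp_of_subsingleton (t 1) (t N) (β (one_dvd_level N)) c₀ c)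
  · obtain ⟨Ψbs, hΨbs, ⟨eΨ⟩⟩ := ThetaFrobenioid.exists_compatBase_of_model_slim
      (𝔉 := (ofConnectedTemperoidFamily h Q odd_l R ιX K' (fun N => (Units.map (tf.ratFnFunctor.map (t N).op).hom).comp c₀)
      hinj hinvc hinvp α β comm_sCap comm_sCup isIsometry_α degFr_α isIsometry_β degFr_β baseFrob_α).atLevel 1) Ψ rfl h
      QuasiTemperoid.BTempConnected.connectedPart_isOfFSMType (SemiGraphs.TemperedArithmeticGroup.isSlim_connectedPart X)
      hnd hN
    haveI := hΨbs
    exact ThetaFrobenioid.units_map_psiAut (𝔉 := (ofConnectedTemperoidFamily h Q odd_l R ιX K' (fun N => (Units.map (tf.ratFnFunctor.map (t N).op).hom).comp c₀)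
      hinj hinvc hinvp α β comm_sCap comm_sCup isIsometry_α degFr_α isIsometry_β degFr_β baseFrob_α).atLevel 1) Ψ (βf 1) Ψbs eΨ

end ThetaFrobenioidTower

end Literature.AnabelianGeometry.EtaleTheta

end
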